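import Mathlib
import HarnessLib

/-!
# `HeteroclinicTriggerChain` — crux `TriggerChainFrontStep` (item stmt-NavierStokesRegularity-22785):
  carrier window with an EXPONENTIALLY DECAYING forcing (the wake pump)

Refinement of the carrier-window lemma of `…ForcedDelay` (constant forcing bound `φ`, drift `φ·t`).
On the lattice the carrier-side remainder of the front block contains the WAKE PUMP
`2^{−5/2}·g·S_{i₁,−1}²` (`…CarrierRow`), and the wake trigger decays exponentially while the new carrier
dominates (`…LatticeWake`): the forcing is `|f₁(t)| ≤ φ₀ + ψ·e^{−λt}`, and over the long delay window
(`t ≍ log(1/β)/e`) the decaying part contributes only `ψ/λ` to the drift, not `ψ·t` (crux note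
`Cruxes/TriggerChainFrontStep/DESIGN-NOTE-p5.md` §6, refinement (1)):

  `D(0) − (2eh² + φ₀)·t − (ψ/λ)(1 − e^{−λt}) ≤ D(t) ≤ D(0) + φ₀·t + (ψ/λ)(1 − e^{−λt})`
  (`heteroclinicTriggerChain_carrierWindowOn_decay`), one-sided derivatives on the window.

HONEST FRAMING: elementary real analysis on a segment; helper lemma for the crux (no stub credit); nothing
here is a statement about the Navier–Stokes equations; no summit, rung or crux is proved by this file.
-/

noncomputable section

set_option linter.dupNamespace false

open Real Set

namespace Summit.NavierStokesRegularity.NavierStokesRegularity.Theorems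

/-- **Carrier window with decaying forcing.** On `[0,T]` (derivatives within the segment) let
`D′ = −2e·u² + f₁` with `e ≥ 0`, `|u| ≤ h`, and `|f₁(t)| ≤ φ₀ + ψ·e^{−λt}` with `λ > 0`. Then
for `t ∈ [0,T]`:
`D(0) − (2eh² + φ₀)t − (ψ/λ)(1 − e^{−λt}) ≤ D(t) ≤ D(0) + φ₀t + (ψ/λ)(1 − e^{−λt})`. [folklore] -/
theorem heteroclinicTriggerChain_carrierWindowOn_decay {e φ₀ ψ lam h T : ℝ} {D u f₁ : ℝ → ℝ}
    (he : 0 ≤ e) (hlam : 0 < lam)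
    (hD : ∀ t ∈ Icc 0 T, HasDerivWithinAt D (-(2 * e * u t ^ 2) + f₁ t) (Icc 0 T) t)
    (hf₁ : ∀ t ∈ Icc 0 T, |f₁ t| ≤ φ₀ + ψ * Real.exp (-(lam * t)))
    (huh : ∀ t ∈ Icc 0 T, |u t| ≤ h) :
    ∀ t ∈ Icc 0 T,
      D 0 - (2 * e * h ^ 2 + φ₀) * t - ψ / lam * (1 - Real.exp (-(lam * t))) ≤ D t ∧
        D t ≤ D 0 + φ₀ * t + ψ / lam * (1 - Real.exp (-(lam * t))) := by
  have hDc : ContinuousOn D (Icc 0 T) := fun s hs => (hD s hs).continuousWithinAt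
  have hD' : ∀ s ∈ Ico 0 T, HasDerivWithinAt D (-(2 * e * u s ^ 2) + f₁ s) (Ici s) s := fun s hs =>
    (hD s (Ico_subset_Icc_self hs)).mono_of_mem_nhdsWithin (Icc_mem_nhdsGE_of_mem hs)
  -- the primitive of ψ e^{-λt}: (ψ/λ)(1 - e^{-λt}), derivative ψ e^{-λt}
  have hE : ∀ s, HasDerivAt (fun s => ψ / lam * (1 - Real.exp (-(lam * s)))) (ψ * Real.exp (-(lam * s))) s := by
    intro s
    have h1 : HasDerivAt (fun s => Real.exp (-(lam * s))) (Real.exp (-(lam * s)) * (-lam)) s := by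
      have h := ((hasDerivAt_id s).const_mul lam).neg.exp
      convert h using 1
      · funext y; simp
      · simp
    have h := (h1.const_sub 1).const_mul (ψ / lam)
    refine h.congr_deriv ?_
    field_simp
  intro t ht
  constructor
  · -- lower fence on -D
    have hB : ∀ s, HasDerivAt (fun s => -D 0 + (2 * e * h ^ 2 + φ₀) * s + ψ / lam * (1 - Real.exp (-(lam * s))))
        ((2 * e * h ^ 2 + φ₀) + ψ * Real.exp (-(lam * s))) s := by
      intro s
      have h := (((hasDerivAt_id s).const_mul (2 * e * h ^ 2 + φ₀)).const_add (-D 0)).add (hE s)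
      refine h.congr_deriv ?_
      simp
    have h := image_le_of_deriv_right_le_deriv_boundary (f := fun s => -D s) (a := 0) (b := T)
      (B := fun s => -D 0 + (2 * e * h ^ 2 + φ₀) * s + ψ / lam * (1 - Real.exp (-(lam * s))))
      (B' := fun s => (2 * e * h ^ 2 + φ₀) + ψ * Real.exp (-(lam * s)))
      hDc.neg (fun s hs => (hD' s hs).neg) (by simp)
      (fun s _ => (hB s).continuousAt.continuousWithinAt) (fun s _ => (hB s).hasDerivWithinAt)
      (fun s hs => by
        have hs' := Ico_subset_Icc_self hs
        have hu2 : u s ^ 2 ≤ h ^ 2 := by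
          have := huh s hs'; have := abs_nonneg (u s); nlinarith [sq_abs (u s)]
        have hf := (abs_le.1 (hf₁ s hs')).1
        show -(-(2 * e * u s ^ 2) + f₁ s) ≤ (2 * e * h ^ 2 + φ₀) + ψ * Real.exp (-(lam * s))
        nlinarith)
      ht
    linarith
  · have hB : ∀ s, HasDerivAt (fun s => D 0 + φ₀ * s + ψ / lam * (1 - Real.exp (-(lam * s))))
        (φ₀ + ψ * Real.exp (-(lam * s))) s := by
      intro s
      have h := (((hasDerivAt_id s).const_mul φ₀).const_add (D 0)).add (hE s)
      refine h.congr_deriv ?_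
      simp
    have h := image_le_of_deriv_right_le_deriv_boundary (f := D) (a := 0) (b := T)
      (B := fun s => D 0 + φ₀ * s + ψ / lam * (1 - Real.exp (-(lam * s))))
      (B' := fun s => φ₀ + ψ * Real.exp (-(lam * s))) hDc hD' (by simp)
      (fun s _ => (hB s).continuousAt.continuousWithinAt) (fun s _ => (hB s).hasDerivWithinAt)
      (fun s hs => by
        have hs' := Ico_subset_Icc_self hs
        have hf := (abs_le.1 (hf₁ s hs')).2
        show -(2 * e * u s ^ 2) + f₁ s ≤ φ₀ + ψ * Real.exp (-(lam * s))
        nlinarith [sq_nonneg (u s)])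
      ht
    exact h

end Summit.NavierStokesRegularity.NavierStokesRegularity.Theorems

end
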